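import Literature.MathematicalPhysics.QuantumFieldTheory.ConformalBootstrap3D.PointKernelK34L505Data
import Literature.MathematicalPhysics.QuantumFieldTheory.ConformalBootstrap3D.PointKernelK34L505Segs

/-!
# K34L505 certificate, kernel block file H2: head segments (monotone coefficient rule; block checker `PCert.hBlockOK` of `PointKernel`, soundness `PCert.hBlockOK_sound`), segments `31 ≤ i < 68`

`decide` by kernel reduction (no `native_decide`, no extra axioms) on the literal data of
`PointKernelK34L505Data`, on the certificate itself (full `s`-width) or on its piece certificates
`pcP_i = certK34L505.withS σ_i σ_(i+1) …` (the cell numbers on an `s`-piece; assembled by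
`CellFactS_of_pieces`).  Estimated kernel time 255 s (5 theorems).
-/

set_option maxRecDepth 100000
set_option maxHeartbeats 0

namespace Literature.MathematicalPhysics.QuantumFieldTheory.ConformalBootstrap3D.PointKernelK34L505

open Literature.MathematicalPhysics.QuantumFieldTheory.ConformalBootstrap3D.PointKernel

/-- segments `[31, 33)` of `hsegsK34L505` pass the kernel evaluator (≈63 s of kernel work). [folklore] -/
theorem hBlock_31 : certK34L505.hBlockOK hsegsK34L505 31 33 JHK34L505 = true := by
  decide +kernel

/-- segments `[33, 35)` of `hsegsK34L505` pass the kernel evaluator (≈57 s of kernel work). [folklore] -/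
theorem hBlock_33 : certK34L505.hBlockOK hsegsK34L505 33 35 JHK34L505 = true := by
  decide +kernel

/-- segments `[35, 46)` of `hsegsK34L505` pass the kernel evaluator (≈51 s of kernel work). [folklore] -/
theorem hBlock_35 : certK34L505.hBlockOK hsegsK34L505 35 46 JHK34L505 = true := by
  decide +kernel

/-- segments `[46, 53)` of `hsegsK34L505` pass the kernel evaluator (≈3 s of kernel work). [folklore] -/
theorem hBlock_46 : certK34L505.hBlockOK hsegsK34L505 46 53 JHK34L505 = true := by
  decide +kernel

/-- segment `[67, 68)` of `hsegsK34L505` passes the kernel evaluator (≈41 s of kernel work). [folklore] -/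
theorem hBlock_67 : certK34L505.hBlockOK hsegsK34L505 67 68 JHK34L505 = true := by
  decide +kernel

end Literature.MathematicalPhysics.QuantumFieldTheory.ConformalBootstrap3D.PointKernelK34L505
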